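import Literature.MathematicalPhysics.QuantumLattice.FinDimSpectrumProofs
import HarnessLib

/-!
# Spectral theory in an invariant coordinate sector

Trunk T-QLATTICE, family `hubbard`. For a Hermitian matrix `A` and a coordinate subspace
`K = {v | v i = 0 unless p i}` which `A` leaves invariant (no matrix entries from `p` to `¬p`),
the sector energy `Matrix.minEnergyOn A K` of `FinDimSpectrum` (the infimum of the Rayleigh
quotient over unit vectors of `K`; this is how `HubbardWave0.groundEnergy` is defined) is
attained at an eigenvector of `A` lying in `K` and bounds the Rayleigh quotient on `K` from
below (`sector_groundState`). Proof: the compression `A.submatrix` to `Subtype p` is Hermitian;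
transport the whole-space facts `groundSpace_ne_bot`, `groundEnergy_le_rayleigh`,
`minEnergyOn_top` of `FinDimSpectrumProofs` along extension by zero. Also a normalisation lemma
`exists_smul_unit`. This is the (elementary) sense in which Lieb, PRL 62 (1989) 1201, "works in
the `S^z = 0` subspace"; Tasaki, *Physics and Mathematics of Quantum Many-Body Systems* (2020)
§2.2. All statements are folklore linear algebra.
-/

noncomputable section

namespace Literature.MathematicalPhysics.QuantumLattice

open Matrix
open scoped ComplexOrder

section SectorSpectrum

variable {ι : Type*} [Fintype ι] [DecidableEq ι]

omit [DecidableEq ι] in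
/-- Normalisation: a nonzero vector has a unit multiple (for `star v ⬝ᵥ v`). [folklore] -/
theorem exists_smul_unit {v : ι → ℂ} (hv : v ≠ 0) : ∃ c : ℂ, c ≠ 0 ∧ star (c • v) ⬝ᵥ (c • v) = 1 := by
  have hpos : 0 < star v ⬝ᵥ v := dotProduct_star_self_pos_iff.2 hv
  obtain ⟨hre, him⟩ := Complex.pos_iff.mp hpos
  set r := Real.sqrt (star v ⬝ᵥ v).re with hr
  have hr0 : 0 < r := Real.sqrt_pos.2 hre
  have hrr : ((r : ℂ)) * r = star v ⬝ᵥ v := by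
    apply Complex.ext
    · simp only [Complex.mul_re, Complex.ofReal_re, Complex.ofReal_im, mul_zero, sub_zero]
      rw [hr, Real.mul_self_sqrt hre.le]
    · simp only [Complex.mul_im, Complex.ofReal_re, Complex.ofReal_im, mul_zero, zero_mul, add_zero]
      exact him
  refine ⟨((r : ℂ))⁻¹, inv_ne_zero (by exact_mod_cast hr0.ne'), ?_⟩
  rw [star_smul, smul_dotProduct, dotProduct_smul, smul_smul, ← hrr, Complex.star_def, map_inv₀,
    Complex.conj_ofReal, smul_eq_mul]
  field_simp [hr0.ne']

omit [DecidableEq ι] in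
/-- A sum of a function vanishing off `p` is a sum over the subtype of `p`. [folklore] -/
theorem sum_eq_sum_subtype_of_support (p : ι → Prop) [DecidablePred p] (f : ι → ℂ)
    (hf : ∀ i, ¬ p i → f i = 0) : ∑ i, f i = ∑ a : Subtype p, f a.1 := by
  rw [← Finset.sum_subtype (Finset.univ.filter p) (by simp), Finset.sum_filter_of_ne]
  intro i _ hi
  by_contra h
  exact hi (hf i h)

/-- **Spectral theory in an invariant coordinate sector.** Let `A` be a Hermitian matrix and
`K = {v | v i = 0 for ¬p i}` a nonzero coordinate subspace which `A` leaves invariant (no matrix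
entries from `p` to `¬p`). Then the sector energy `minEnergyOn A K` (infimum of the Rayleigh
quotient over unit vectors of `K`) is attained at an eigenvector of `A` in `K`, and bounds the
Rayleigh quotient on `K` from below. (Compression `A|_K = A.submatrix` is Hermitian; apply the
whole-space facts `groundSpace_ne_bot`, `groundEnergy_le_rayleigh`, `minEnergyOn_top` of
`FinDimSpectrum` to it.) Tasaki (2020) §2.2; Lieb (1989) works "in the `S^z = 0` subspace" in this
sense. [folklore] -/
theorem sector_groundState (A : Matrix ι ι ℂ) (hA : A.IsHermitian) (p : ι → Prop) [DecidablePred p]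
    (hp : ∃ i, p i) (hinv : ∀ i j, ¬ p i → p j → A i j = 0)
    (K : Submodule ℂ (ι → ℂ)) (hK : ∀ v, v ∈ K ↔ ∀ i, ¬ p i → v i = 0) :
    (∃ v ∈ K, v ≠ 0 ∧ A *ᵥ v = ((A.minEnergyOn K : ℝ) : ℂ) • v) ∧
      ∀ v ∈ K, star v ⬝ᵥ v = 1 → A.minEnergyOn K ≤ (star v ⬝ᵥ A *ᵥ v).re := by
  obtain ⟨i₀, hi₀⟩ := hp
  haveI : Nonempty (Subtype p) := ⟨⟨i₀, hi₀⟩⟩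
  set B : Matrix (Subtype p) (Subtype p) ℂ := A.submatrix Subtype.val Subtype.val with hB
  have hBh : B.IsHermitian := hA.submatrix _
  -- extension by zero and restriction
  set ext : (Subtype p → ℂ) → (ι → ℂ) := fun φ i => if h : p i then φ ⟨i, h⟩ else 0 with hext
  set res : (ι → ℂ) → (Subtype p → ℂ) := fun v a => v a.1 with hres
  have hext_apply : ∀ φ (a : Subtype p), ext φ a.1 = φ a := fun φ a => by simp [hext, a.2]
  have hext_not : ∀ φ i, ¬ p i → ext φ i = 0 := fun φ i hi => by simp [hext, hi]
  have hres_ext : ∀ φ, res (ext φ) = φ := fun φ => funext fun a => hext_apply φ a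
  have hext_res : ∀ v ∈ K, ext (res v) = v := by
    intro v hv; funext i
    by_cases hi : p i
    · exact hext_apply (res v) ⟨i, hi⟩
    · rw [hext_not _ i hi, ((hK v).1 hv) i hi]
  have hext_mem : ∀ φ, ext φ ∈ K := fun φ => (hK _).2 fun i hi => hext_not φ i hi
  have hext_smul : ∀ (c : ℂ) φ, ext (c • φ) = c • ext φ := by
    intro c φ; funext i; by_cases hi : p i <;> simp [hext, hi]
  -- `A` acts on `K` as `B`
  have hAext : ∀ φ, A *ᵥ ext φ = ext (B *ᵥ φ) := by
    intro φ; funext i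
    rw [mulVec, dotProduct]
    by_cases hi : p i
    · have h1 : ext (B *ᵥ φ) i = (B *ᵥ φ) ⟨i, hi⟩ := hext_apply (B *ᵥ φ) ⟨i, hi⟩
      rw [h1, mulVec, dotProduct, sum_eq_sum_subtype_of_support p]
      · refine Finset.sum_congr rfl fun a _ => ?_
        rw [hext_apply]; rfl
      · intro j hj; rw [hext_not φ j hj, mul_zero]
    · rw [hext_not _ i hi]
      refine Finset.sum_eq_zero fun j _ => ?_
      by_cases hj : p j
      · rw [hinv i j hi hj, zero_mul]
      · rw [hext_not φ j hj, mul_zero]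
  have hdot : ∀ φ (w : ι → ℂ), star (ext φ) ⬝ᵥ w = star φ ⬝ᵥ res w := by
    intro φ w
    rw [dotProduct, dotProduct, sum_eq_sum_subtype_of_support p]
    · refine Finset.sum_congr rfl fun a _ => ?_
      rw [Pi.star_apply, Pi.star_apply, hext_apply]
    · intro j hj; rw [Pi.star_apply, hext_not φ j hj, star_zero, zero_mul]
  -- the Rayleigh sets coincide, hence `minEnergyOn A K = groundEnergy B`
  have hset : {E : ℝ | ∃ ψ ∈ K, star ψ ⬝ᵥ ψ = 1 ∧ E = (star ψ ⬝ᵥ A *ᵥ ψ).re} =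
      {E : ℝ | ∃ φ ∈ (⊤ : Submodule ℂ (Subtype p → ℂ)), star φ ⬝ᵥ φ = 1 ∧ E = (star φ ⬝ᵥ B *ᵥ φ).re} := by
    ext E
    constructor
    · rintro ⟨ψ, hψK, hψ1, rfl⟩
      refine ⟨res ψ, Submodule.mem_top, ?_, ?_⟩
      · rw [← hψ1, ← hext_res ψ hψK, hdot, hres_ext]
      · conv_lhs => rw [← hext_res ψ hψK, hAext, hdot, hres_ext]
    · rintro ⟨φ, -, hφ1, rfl⟩
      refine ⟨ext φ, hext_mem φ, ?_, ?_⟩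
      · rw [hdot, hres_ext, hφ1]
      · rw [hAext, hdot, hres_ext]
  have hmin : A.minEnergyOn K = B.groundEnergy := by
    rw [Matrix.minEnergyOn, hset, ← Matrix.minEnergyOn_top_holds hBh]; rfl
  constructor
  · obtain ⟨φ, hφ, hφ0⟩ := (Submodule.ne_bot_iff _).1 (Matrix.groundSpace_ne_bot_holds hBh)
    rw [Matrix.mem_groundSpace_iff] at hφ
    refine ⟨ext φ, hext_mem φ, fun h => hφ0 ?_, ?_⟩
    · rw [← hres_ext φ, h]; rfl
    · rw [hAext, hφ, hmin]; exact hext_smul _ φ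
  · intro v hv hv1
    rw [hmin]
    have h1 : star (res v) ⬝ᵥ res v = 1 := by rw [← hv1, ← hext_res v hv, hdot, hres_ext]
    have h := Matrix.groundEnergy_le_rayleigh_holds hBh (res v) h1
    conv_rhs => rw [← hext_res v hv, hAext, hdot, hres_ext]
    exact h

end SectorSpectrum

end Literature.MathematicalPhysics.QuantumLattice
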